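import Literature.Algebra.Polynomial.BinomialTypeSequences
import Literature.Algebra.Polynomial.HermiteAppellSequence
import Literature.Algebra.Polynomial.PowerSeriesInDeltaOperator
import Mathlib.LinearAlgebra.Basis.Bilinear
import Mathlib.Tactic
import HarnessLib

/-!
# The natural inner product and the eigen-operator of a Sheffer set (Rota–Kahaner–Odlyzko §9)

G.-C. Rota, D. Kahaner, A. Odlyzko, *Finite operator calculus* (1973), §9 "Eigenfunction
expansions", pp. 716–720, §10 p. 726 and §13 p. 736:

> … let `s_n (x)` be a Sheffer set relative to the invertible operator `S` and the delta operator
> `Q` [`s_n = S⁻¹ p_n`]. Let `W : s_n (x) → xⁿ` be the umbral operator sending `s_n (x)` to `xⁿ`. For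
> arbitrary polynomials `f (x)` and `g (x)` set `(f (x), g (x)) = [(W f)(Q) S g (x)]_{x=0}` (*).
> **Proposition 1.** The bilinear form `(f (x), g (x))` defined by (*) on the vector space of all
> polynomials is a positive-definite inner product. *Proof.* It suffices to show that
> `(s_k (x), s_n (x)) = 0` for `k ≠ n` and `(s_n (x), s_n (x)) > 0` … Now
> `(s_k, s_n) = [Q^k S s_n]_{x=0} = [Q^k p_n (x)]_{x=0} = (n)_k p_{n−k} (0) = n! δ_{nk}`.
> **Theorem 9.** For any Sheffer sequence `s_n (x)` with delta operator `Q` and operator `S` there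
> exists a unique operator of the form `A = Σ_{k≥1} (u_k + x v_k)/(k−1)! · Q^k` with the following
> properties: (a) `A` is essentially self adjoint (and densely defined) in the Hilbert space `H`
> obtained by completing the space `P` of polynomials in the associated inner product (*); (b) the
> spectrum of `A` consists of simple eigenvalues at `0, 1, 2, …`; the eigenfunction associated with
> the eigenvalue `n` is the polynomial `s_n (x)`; (c) `u_k = −[(log S)′ q_{k−1} (x)]_{x=0}`,
> `v_k = p_k′ (0)`, where `p_k (x)` are the basic polynomials for the delta operator `Q` [and
> `q_{k−1} = (Q′)⁻¹ p_{k−1} = p_k/x`, proof p. 718: "`T = (a − (log S)′) Q (Q′)⁻¹`",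
> "`u_k = −[S⁻¹S′ q_{k−1} (x)]_{x=0} = −[(log S)′ q_{k−1} (x)]_{x=0}`, `v_k = q_{k−1} (0)`"].
> (§10, p. 726) We have `(log S)′ = D`, since `S = W₁`, so that the formulas given there yield
> `u₂ = −1`, `v₁ = 1` and all other coefficients `0`. We conclude that the Hermite polynomials are a
> complete sequence of eigenfunctions, with eigenvalues `n`, of the operator `A = xD − D²`.
> (§13, p. 736) If `p_n (x) = T⁻¹ xⁿ`, then an easy computation gives
> `p_{n+1} (x) = ((T⁻¹)′ T + x) p_n (x)`, a useful recurrence formula which yields various classical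
> formulas (for example, the recurrence for Hermite polynomials).

What is typed here is the ALGEBRA of §9: the form (*) (`shefferInner`, through explicit renderings
of `W` and `S` on the basis `(s_n)`), its Gram values `(s_k, s_n) = n! δ_{kn}` (`shefferInner_seq`),
bilinearity (`shefferForm`), symmetry, the coordinate formula `(f, g) = Σ_n n! f_n g_n` and positive
definiteness over an ordered field (Proposition 1); the operator `A` in the closed form obtained in
the proof, `A = x (Q′)⁻¹ Q − (log S)′ (Q′)⁻¹ Q` for `Q = D φ(D)`, `S = σ(D)` (`shefferEigenOp φ σ`, a
definition with body), the eigen-property `A s_n = n s_n` (Theorem 9 (b)), its expansion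
`A = Σ_{k≥1} (u_k + x v_k)/(k−1)! Q^k` with the printed `u_k`, `v_k` (Theorem 9, form and (c)), the
uniqueness of these coefficients, the symmetry of `A` for (*) (the algebraic content of (a)), the
Hermite instance `A = xD − D²` and the §13 recurrence for Appell sets. The Hilbert-space completion,
essential self-adjointness and completeness of eigenfunctions (analysis) are NOT typed, nor
Corollaries 1–3.

## References
* [RotaKahanerOdlyzko1973] G.-C. Rota, D. Kahaner, A. Odlyzko, *On the foundations of
  combinatorial theory VIII. Finite operator calculus*, J. Math. Anal. Appl. 42 (1973) 684–760,
  §9 pp. 716–720 (Proposition 1, Theorem 9), §10 p. 726, §13 p. 736.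
-/

noncomputable section

open Polynomial Finset

namespace Literature.Algebra.Polynomial

variable {K : Type*} [Field K] [CharZero K]

/-! ## The natural inner product (*) -/

section Inner

variable {δ : K[X] →ₗ[K] K[X]} {s : ℕ → K[X]}

/-- **The natural inner product** `(f, g) = [(W f)(Q) S g]_{x=0}` associated with the Sheffer set `s_n`
of `S`, `Q` (`s_n = S⁻¹ p_n`): `W` is the umbral operator `s_n ↦ xⁿ`, `S` the operator `s_n ↦ p_n`
(`p_n` the basic set of `Q`), and `(W f)(Q)` the polynomial `W f` evaluated at the operator `Q`.
[cite: RotaKahanerOdlyzko1973, §9 (*), p. 716] -/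
def shefferInner (hδ : IsDeltaOperator δ) (hs : IsShefferSequence δ s) (f g : K[X]) : K :=
  ((Polynomial.aeval δ ((seqBasis hs.degree_eq).constr K (fun n : ℕ => (X : K[X]) ^ n) f))
    ((seqBasis hs.degree_eq).constr K hδ.basicSequence g)).eval 0

/-- Unfolding. [cite: RotaKahanerOdlyzko1973, §9 (*), p. 716] -/
theorem shefferInner_eq (hδ : IsDeltaOperator δ) (hs : IsShefferSequence δ s) (f g : K[X]) :
    shefferInner hδ hs f g = ((Polynomial.aeval δ ((seqBasis hs.degree_eq).constr K
      (fun n : ℕ => (X : K[X]) ^ n) f)) ((seqBasis hs.degree_eq).constr K hδ.basicSequence g)).eval 0 :=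
  rfl

omit [CharZero K] in
/-- `W s_k = xᵏ`. [cite: RotaKahanerOdlyzko1973, §9, p. 716] -/
theorem constr_X_pow_apply (hs : IsShefferSequence δ s) (k : ℕ) :
    (seqBasis hs.degree_eq).constr K (fun n : ℕ => (X : K[X]) ^ n) (s k) = X ^ k := by
  have h := (seqBasis hs.degree_eq).constr_basis K (fun n : ℕ => (X : K[X]) ^ n) k
  rwa [seqBasis_apply] at h

/-- `S s_k = p_k`. [cite: RotaKahanerOdlyzko1973, §9, p. 716] -/
theorem constr_basicSequence_apply (hδ : IsDeltaOperator δ) (hs : IsShefferSequence δ s) (k : ℕ) :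
    (seqBasis hs.degree_eq).constr K hδ.basicSequence (s k) = hδ.basicSequence k := by
  have h := (seqBasis hs.degree_eq).constr_basis K hδ.basicSequence k
  rwa [seqBasis_apply] at h

/-- **The Gram values `(s_k, s_n) = [Q^k S s_n]_{x=0} = [Q^k p_n]_{x=0} = (n)_k p_{n−k} (0) = n! δ_{nk}`.**
[cite: RotaKahanerOdlyzko1973, §9 Proposition 1 (proof), p. 716] -/
theorem shefferInner_seq (hδ : IsDeltaOperator δ) (hs : IsShefferSequence δ s) (k n : ℕ) :
    shefferInner hδ hs (s k) (s n) = if k = n then (n.factorial : K) else 0 := by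
  have hp := hδ.isBasicSequence_basicSequence
  rw [shefferInner_eq, constr_X_pow_apply hs k, constr_basicSequence_apply hδ hs n, aeval_X_pow, hp.pow_apply hδ k n,
    eval_smul, smul_eq_mul]
  rcases lt_trichotomy k n with h | rfl | h
  · rw [hp.eval_zero (Nat.sub_ne_zero_of_lt h), mul_zero, if_neg h.ne]
  · rw [Nat.sub_self, hp.apply_zero, eval_one, mul_one, Nat.descFactorial_self, if_pos rfl]
  · rw [Nat.descFactorial_eq_zero_iff_lt.2 h, Nat.cast_zero, zero_mul, if_neg h.ne']

/-- `(s_n, s_n) = n!`. [cite: RotaKahanerOdlyzko1973, §9 Proposition 1 (proof), p. 716] -/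
theorem shefferInner_seq_self (hδ : IsDeltaOperator δ) (hs : IsShefferSequence δ s) (n : ℕ) :
    shefferInner hδ hs (s n) (s n) = (n.factorial : K) := by
  rw [shefferInner_seq, if_pos rfl]

/-- `(s_k, s_n) = 0` for `k ≠ n` (orthogonality of the Sheffer set).
[cite: RotaKahanerOdlyzko1973, §9 Proposition 1 (proof), p. 716] -/
theorem shefferInner_seq_of_ne (hδ : IsDeltaOperator δ) (hs : IsShefferSequence δ s) {k n : ℕ}
    (h : k ≠ n) : shefferInner hδ hs (s k) (s n) = 0 := by
  rw [shefferInner_seq, if_neg h]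

/-- **(*) is a bilinear form** on `K[X]`. [cite: RotaKahanerOdlyzko1973, §9 Proposition 1, p. 716] -/
def shefferForm (hδ : IsDeltaOperator δ) (hs : IsShefferSequence δ s) : K[X] →ₗ[K] K[X] →ₗ[K] K :=
  LinearMap.mk₂ K (shefferInner hδ hs)
    (fun f₁ f₂ g => by
      simp only [shefferInner_eq, map_add, LinearMap.add_apply, eval_add])
    (fun c f g => by
      simp only [shefferInner_eq, map_smul, LinearMap.smul_apply, eval_smul, smul_eq_mul])
    (fun f g₁ g₂ => by
      simp only [shefferInner_eq, map_add, eval_add])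
    (fun c f g => by
      simp only [shefferInner_eq, map_smul, eval_smul, smul_eq_mul])

/-- Unfolding. [cite: RotaKahanerOdlyzko1973, §9 (*), p. 716] -/
theorem shefferForm_apply (hδ : IsDeltaOperator δ) (hs : IsShefferSequence δ s) (f g : K[X]) :
    shefferForm hδ hs f g = shefferInner hδ hs f g :=
  rfl

/-- **(*) is symmetric** (it is diagonal on the basis `(s_n)`).
[cite: RotaKahanerOdlyzko1973, §9 Proposition 1, p. 716] -/
theorem shefferForm_flip (hδ : IsDeltaOperator δ) (hs : IsShefferSequence δ s) :
    (shefferForm hδ hs).flip = shefferForm hδ hs := by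
  refine LinearMap.ext_basis (seqBasis hs.degree_eq) (seqBasis hs.degree_eq) fun i j => ?_
  rw [LinearMap.flip_apply, seqBasis_apply, seqBasis_apply, shefferForm_apply, shefferForm_apply,
    shefferInner_seq, shefferInner_seq]
  by_cases h : i = j
  · subst h; rfl
  · rw [if_neg h, if_neg (Ne.symm h)]

/-- `(f, g) = (g, f)`. [cite: RotaKahanerOdlyzko1973, §9 Proposition 1, p. 716] -/
theorem shefferInner_comm (hδ : IsDeltaOperator δ) (hs : IsShefferSequence δ s) (f g : K[X]) :
    shefferInner hδ hs f g = shefferInner hδ hs g f := by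
  rw [← shefferForm_apply, ← shefferForm_flip hδ hs, LinearMap.flip_apply, shefferForm_apply]

/-- **The coordinate formula `(f, g) = Σ_n n! f_n g_n`** for `f = Σ f_n s_n`, `g = Σ g_n s_n`
(coordinates in the basis `(s_n)`; the sum runs over the `s`-support of `f`).
[cite: RotaKahanerOdlyzko1973, §9 Proposition 1 (proof), p. 716] -/
theorem shefferInner_eq_sum_repr (hδ : IsDeltaOperator δ) (hs : IsShefferSequence δ s) (f g : K[X]) :
    shefferInner hδ hs f g = ((seqBasis hs.degree_eq).repr f).sum
      fun n a => a * (seqBasis hs.degree_eq).repr g n * (n.factorial : K) := by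
  classical
  rw [← shefferForm_apply, ← LinearMap.sum_repr_mul_repr_mul (seqBasis hs.degree_eq) (seqBasis hs.degree_eq)]
  refine Finsupp.sum_congr fun i _ => ?_
  rw [Finsupp.sum]
  have hterm : ∀ j ∈ ((seqBasis hs.degree_eq).repr g).support,
      (seqBasis hs.degree_eq).repr f i • (seqBasis hs.degree_eq).repr g j •
        shefferForm hδ hs (seqBasis hs.degree_eq i) (seqBasis hs.degree_eq j) =
      if i = j then (seqBasis hs.degree_eq).repr f i * (seqBasis hs.degree_eq).repr g i * (i.factorial : K)
        else 0 := by
    intro j _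
    rw [seqBasis_apply, seqBasis_apply, shefferForm_apply, shefferInner_seq]
    by_cases h : i = j
    · subst h
      rw [if_pos rfl, if_pos rfl, smul_eq_mul, smul_eq_mul, mul_assoc]
    · rw [if_neg h, if_neg h, smul_zero, smul_zero]
  rw [sum_congr rfl hterm, sum_ite_eq]
  by_cases hi : i ∈ ((seqBasis hs.degree_eq).repr g).support
  · rw [if_pos hi]
  · rw [if_neg hi, Finsupp.notMem_support_iff.1 hi, mul_zero, zero_mul]

/-- `(f, f) = Σ_n n! f_n²`. [cite: RotaKahanerOdlyzko1973, §9 Proposition 1 (proof), p. 716] -/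
theorem shefferInner_self_eq_sum (hδ : IsDeltaOperator δ) (hs : IsShefferSequence δ s) (f : K[X]) :
    shefferInner hδ hs f f = ((seqBasis hs.degree_eq).repr f).sum fun n a => a * a * (n.factorial : K) :=
  shefferInner_eq_sum_repr hδ hs f f

/-- **Proposition 1, positivity**: over an ordered field `(f, f) ≥ 0` …
[cite: RotaKahanerOdlyzko1973, §9 Proposition 1, p. 716] -/
theorem shefferInner_self_nonneg {K : Type*} [Field K] [LinearOrder K] [IsStrictOrderedRing K]
    {δ : K[X] →ₗ[K] K[X]} {s : ℕ → K[X]} (hδ : IsDeltaOperator δ) (hs : IsShefferSequence δ s)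
    (f : K[X]) : 0 ≤ shefferInner hδ hs f f := by
  rw [shefferInner_self_eq_sum, Finsupp.sum]
  exact sum_nonneg fun n _ => mul_nonneg (mul_self_nonneg _) (Nat.cast_nonneg _)

/-- **Proposition 1, definiteness**: `(f, f) = 0` only for `f = 0` — (*) is a positive-definite inner
product on the space of polynomials. [cite: RotaKahanerOdlyzko1973, §9 Proposition 1, p. 716] -/
theorem shefferInner_self_eq_zero_iff {K : Type*} [Field K] [LinearOrder K] [IsStrictOrderedRing K]
    {δ : K[X] →ₗ[K] K[X]} {s : ℕ → K[X]} (hδ : IsDeltaOperator δ) (hs : IsShefferSequence δ s)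
    (f : K[X]) : shefferInner hδ hs f f = 0 ↔ f = 0 := by
  refine ⟨fun h => ?_, fun h => by simp only [h, ← shefferForm_apply, map_zero]⟩
  rw [shefferInner_self_eq_sum, Finsupp.sum] at h
  have hz := (sum_eq_zero_iff_of_nonneg fun n _ =>
    mul_nonneg (mul_self_nonneg _) (Nat.cast_nonneg _)).1 h
  have hrepr : (seqBasis hs.degree_eq).repr f = 0 := by
    ext n
    by_contra hn
    have hmem : n ∈ ((seqBasis hs.degree_eq).repr f).support := Finsupp.mem_support_iff.2 hn
    have h0 := hz n hmem
    rw [mul_eq_zero, mul_self_eq_zero] at h0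
    rcases h0 with h0 | h0
    · exact hn h0
    · exact Nat.factorial_ne_zero n (Nat.cast_eq_zero.1 h0)
  exact (seqBasis hs.degree_eq).repr.map_eq_zero_iff.1 hrepr

/-- `(f, f) > 0` for `f ≠ 0`. [cite: RotaKahanerOdlyzko1973, §9 Proposition 1, p. 716] -/
theorem shefferInner_self_pos {K : Type*} [Field K] [LinearOrder K] [IsStrictOrderedRing K]
    {δ : K[X] →ₗ[K] K[X]} {s : ℕ → K[X]} (hδ : IsDeltaOperator δ) (hs : IsShefferSequence δ s)
    {f : K[X]} (hf : f ≠ 0) : 0 < shefferInner hδ hs f f :=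
  lt_of_le_of_ne (shefferInner_self_nonneg hδ hs f) fun h => hf ((shefferInner_self_eq_zero_iff hδ hs f).1 h.symm)

/-- **Symmetry of the eigen-operator for (*)** (the algebraic content of Theorem 9 (a)): an operator with
`A s_n = n s_n` satisfies `(A f, g) = (f, A g)`. [cite: RotaKahanerOdlyzko1973, §9 Theorem 9 (a)–(b),
p. 717] -/
theorem shefferInner_map_comm (hδ : IsDeltaOperator δ) (hs : IsShefferSequence δ s)
    {A : K[X] →ₗ[K] K[X]} (hA : ∀ n, A (s n) = (n : K) • s n) (f g : K[X]) :
    shefferInner hδ hs (A f) g = shefferInner hδ hs f (A g) := by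
  have h : (shefferForm hδ hs).comp A = (shefferForm hδ hs).compl₂ A := by
    refine LinearMap.ext_basis (seqBasis hs.degree_eq) (seqBasis hs.degree_eq) fun i j => ?_
    rw [LinearMap.comp_apply, LinearMap.compl₂_apply, seqBasis_apply, seqBasis_apply, hA, hA, map_smul,
      map_smul, LinearMap.smul_apply]
    change (i : K) • shefferInner hδ hs (s i) (s j) = (j : K) • shefferInner hδ hs (s i) (s j)
    rw [shefferInner_seq]
    by_cases hij : i = j
    · subst hij; rfl
    · rw [if_neg hij, smul_zero, smul_zero]
  have h' := congrArg (fun B : K[X] →ₗ[K] K[X] →ₗ[K] K => B f g) h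
  simpa only [LinearMap.comp_apply, LinearMap.compl₂_apply, shefferForm_apply] using h'

end Inner

/-! ## Theorem 9: the eigen-operator `A`, `A s_n = n s_n` -/

section Eigen

variable {φ σ : PowerSeries K} {s : ℕ → K[X]}

/-- **The operator `A` of Theorem 9 in closed form** (proof p. 717: `T = (a − (log S)′) Q (Q′)⁻¹`): for
`Q = D φ(D)` (so `(Q′)⁻¹ Q = ((tφ)′⁻¹ · tφ)(D)`) and `S = σ(D)` (so `(log S)′ = (σ′/σ)(D)`),
`A = x · (Q′)⁻¹ Q − (log S)′ (Q′)⁻¹ Q`. [cite: RotaKahanerOdlyzko1973, §9 Theorem 9 (proof), pp. 717–719] -/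
def shefferEigenOp (φ σ : PowerSeries K) : K[X] →ₗ[K] K[X] :=
  LinearMap.mulLeft K (X : K[X]) ∘ₗ
      diffOp ((PowerSeries.derivative K (PowerSeries.X * φ))⁻¹ * (PowerSeries.X * φ)) -
    diffOp (PowerSeries.derivative K σ * σ⁻¹ *
      ((PowerSeries.derivative K (PowerSeries.X * φ))⁻¹ * (PowerSeries.X * φ)))

omit [CharZero K] in
/-- Unfolding on a polynomial. [cite: RotaKahanerOdlyzko1973, §9 Theorem 9 (proof), pp. 717–719] -/
theorem shefferEigenOp_apply (φ σ : PowerSeries K) (f : K[X]) :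
    shefferEigenOp φ σ f =
      X * diffOp ((PowerSeries.derivative K (PowerSeries.X * φ))⁻¹ * (PowerSeries.X * φ)) f -
        diffOp (PowerSeries.derivative K σ * σ⁻¹ *
          ((PowerSeries.derivative K (PowerSeries.X * φ))⁻¹ * (PowerSeries.X * φ))) f := by
  rw [shefferEigenOp, LinearMap.sub_apply, LinearMap.comp_apply, LinearMap.mulLeft_apply]

/-- **The Pincherle conjugation `S⁻¹ x S = x − S⁻¹ S′`** in the form used: for `S = σ(D)`,
`σ⁻¹(D) (x r) = x σ⁻¹(D) r − (σ′ σ⁻¹)(D) σ⁻¹(D) r`.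
[cite: RotaKahanerOdlyzko1973, §9 Theorem 9 (proof: "`−S⁻¹S′`"), pp. 717–718] -/
theorem diffOp_inv_X_mul (σ : PowerSeries K) (r : K[X]) :
    diffOp σ⁻¹ (X * r) = X * diffOp σ⁻¹ r - diffOp (PowerSeries.derivative K σ * σ⁻¹) (diffOp σ⁻¹ r) := by
  have h := X_mul_diffOp σ⁻¹ r
  rw [PowerSeries.derivative_inv'] at h
  have h2 : diffOp (-σ⁻¹ ^ 2 * PowerSeries.derivative K σ) r =
      -(diffOp (PowerSeries.derivative K σ * σ⁻¹) (diffOp σ⁻¹ r)) := by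
    rw [← LinearMap.comp_apply, ← diffOp_mul, ← LinearMap.neg_apply, ← diffOp_neg]
    congr 2
    ring
  rw [h2, sub_neg_eq_add] at h
  rw [eq_sub_iff_add_eq]
  exact h.symm

/-- `(Q′)⁻¹ Q p_0 = 0` and the key step `(Q′)⁻¹ Q p_{m+1} = (m+1) (Q′)⁻¹ p_m` with `x (Q′)⁻¹ p_m = p_{m+1}`
(Rodrigues). [cite: RotaKahanerOdlyzko1973, §9 Theorem 9 (proof: "Rodrigues' formula now reads …"),
p. 718] -/
theorem diffOp_quot_basicSequence_succ (hφ : PowerSeries.constantCoeff φ ≠ 0) (m : ℕ) :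
    diffOp ((PowerSeries.derivative K (PowerSeries.X * φ))⁻¹ * (PowerSeries.X * φ))
        ((isDeltaOperator_derivative_comp_diffOp hφ).basicSequence (m + 1)) =
      ((m + 1 : ℕ) : K) • diffOp (PowerSeries.derivative K (PowerSeries.X * φ))⁻¹
        ((isDeltaOperator_derivative_comp_diffOp hφ).basicSequence m) := by
  have hb := (isDeltaOperator_derivative_comp_diffOp hφ).isBasicSequence_basicSequence
  rw [diffOp_mul, LinearMap.comp_apply, ← derivative_comp_diffOp_eq, hb.map_succ, map_smul]

/-- `(Q′)⁻¹ Q p_0 = 0`. [cite: RotaKahanerOdlyzko1973, §9 Theorem 9 (proof), p. 718] -/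
theorem diffOp_quot_basicSequence_zero (hφ : PowerSeries.constantCoeff φ ≠ 0) :
    diffOp ((PowerSeries.derivative K (PowerSeries.X * φ))⁻¹ * (PowerSeries.X * φ))
        ((isDeltaOperator_derivative_comp_diffOp hφ).basicSequence 0) = 0 := by
  have hb := (isDeltaOperator_derivative_comp_diffOp hφ).isBasicSequence_basicSequence
  rw [diffOp_mul, LinearMap.comp_apply, ← derivative_comp_diffOp_eq, hb.apply_zero,
    (isDeltaOperator_derivative_comp_diffOp hφ).map_one, map_zero]

/-- **Theorem 9 (b): `A s_n = n s_n`** — the Sheffer set `s_n = S⁻¹ p_n` (here: `S s_n = p_n` with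
`S = σ(D)` invertible, `p_n` basic for `Q = D φ(D)`) consists of eigenfunctions of `A` with eigenvalues
`n = 0, 1, 2, …`. [cite: RotaKahanerOdlyzko1973, §9 Theorem 9 (b), pp. 717–719] -/
theorem shefferEigenOp_apply_sheffer (hφ : PowerSeries.constantCoeff φ ≠ 0)
    (hσ : PowerSeries.constantCoeff σ ≠ 0)
    (hs : ∀ n, diffOp σ (s n) = (isDeltaOperator_derivative_comp_diffOp hφ).basicSequence n) (n : ℕ) :
    shefferEigenOp φ σ (s n) = (n : K) • s n := by
  set p := (isDeltaOperator_derivative_comp_diffOp hφ).basicSequence with hpdef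
  have hsn : ∀ n, s n = diffOp σ⁻¹ (p n) := fun n => by
    rw [← hs n, ← LinearMap.comp_apply, diffOp_inv_comp_diffOp hσ, LinearMap.id_apply]
  rw [shefferEigenOp_apply, hsn n, (isShiftInvariant_diffOp _).comm_apply (isShiftInvariant_diffOp σ⁻¹),
    (isShiftInvariant_diffOp (PowerSeries.derivative K σ * σ⁻¹ * _)).comm_apply (isShiftInvariant_diffOp σ⁻¹)]
  cases n with
  | zero =>
    rw [hpdef, diffOp_quot_basicSequence_zero hφ, diffOp_mul, LinearMap.comp_apply,
      diffOp_quot_basicSequence_zero hφ, map_zero, map_zero, map_zero, mul_zero, sub_zero, Nat.cast_zero,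
      zero_smul]
  | succ m =>
    rw [hpdef, diffOp_mul (PowerSeries.derivative K σ * σ⁻¹), LinearMap.comp_apply,
      diffOp_quot_basicSequence_succ hφ m, map_smul, map_smul, map_smul, mul_smul_comm, ← smul_sub,
      (isShiftInvariant_diffOp σ⁻¹).comm_apply (isShiftInvariant_diffOp (PowerSeries.derivative K σ * σ⁻¹)),
      ← diffOp_inv_X_mul σ, ← basicSequence_derivative_comp_diffOp_succ hφ m]

/-- **Theorem 9, the form of `A` and (c)**: on every polynomial `f` (`N > deg f`),
`A f = Σ_{k=1}^{N} (u_k + x v_k)/(k−1)! · Q^k f` with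
`u_k = −[(log S)′ q_{k−1} (x)]_{x=0}`, `q_{k−1} = (Q′)⁻¹ p_{k−1}`, and `v_k = p_k′ (0)`
(written with `k = j + 1`). [cite: RotaKahanerOdlyzko1973, §9 Theorem 9 (c), pp. 717–719] -/
theorem shefferEigenOp_apply_eq_sum (hφ : PowerSeries.constantCoeff φ ≠ 0) (σ : PowerSeries K) (f : K[X])
    {N : ℕ} (hN : f.natDegree < N) :
    shefferEigenOp φ σ f = ∑ j ∈ range N,
      ((-(diffOp (PowerSeries.derivative K σ * σ⁻¹) (diffOp (PowerSeries.derivative K (PowerSeries.X * φ))⁻¹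
            ((isDeltaOperator_derivative_comp_diffOp hφ).basicSequence j))).eval 0 / (j.factorial : K)) •
          ((derivative ∘ₗ diffOp φ) ^ (j + 1)) f +
        ((derivative ((isDeltaOperator_derivative_comp_diffOp hφ).basicSequence (j + 1))).eval 0 /
            (j.factorial : K)) • (X * ((derivative ∘ₗ diffOp φ) ^ (j + 1)) f)) := by
  have hp := (isDeltaOperator_derivative_comp_diffOp hφ).isBasicSequence_basicSequence
  set u : PowerSeries K := (PowerSeries.derivative K (PowerSeries.X * φ))⁻¹ * (PowerSeries.X * φ) with hudef
  set l : PowerSeries K := PowerSeries.derivative K σ * σ⁻¹ with hldef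
  -- `v_k`: `[(Q′)⁻¹ p_j]_{x=0} = p_{j+1}′ (0)` since `p_{j+1} = x (Q′)⁻¹ p_j`
  have hv : ∀ j, (diffOp (PowerSeries.derivative K (PowerSeries.X * φ))⁻¹
      ((isDeltaOperator_derivative_comp_diffOp hφ).basicSequence j)).eval 0 =
      (derivative ((isDeltaOperator_derivative_comp_diffOp hφ).basicSequence (j + 1))).eval 0 := fun j => by
    rw [basicSequence_derivative_comp_diffOp_succ hφ j, derivative_mul, derivative_X, one_mul, eval_add,
      eval_mul, eval_X, zero_mul, add_zero]
  -- first expansion of the shift-invariant `U = (Q′)⁻¹ Q` and `L U`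
  have hU := (isShiftInvariant_diffOp u).eq_sum_pow_apply (isDeltaOperator_derivative_comp_diffOp hφ) hp f
    (N := N + 1) (by omega)
  have hLU := (isShiftInvariant_diffOp (l * u)).eq_sum_pow_apply (isDeltaOperator_derivative_comp_diffOp hφ)
    hp f (N := N + 1) (by omega)
  have h0 : diffOp u ((isDeltaOperator_derivative_comp_diffOp hφ).basicSequence 0) = 0 := by
    rw [hudef, diffOp_quot_basicSequence_zero hφ]
  have h0' : diffOp (l * u) ((isDeltaOperator_derivative_comp_diffOp hφ).basicSequence 0) = 0 := by
    rw [diffOp_mul, LinearMap.comp_apply, h0, map_zero]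
  rw [sum_range_succ', h0, Polynomial.eval_zero, zero_div, zero_smul, add_zero] at hU
  rw [sum_range_succ', h0', Polynomial.eval_zero, zero_div, zero_smul, add_zero] at hLU
  rw [shefferEigenOp_apply, ← hudef, ← hldef, hU, hLU, mul_sum, ← sum_sub_distrib]
  refine sum_congr rfl fun j _ => ?_
  rw [diffOp_mul l u, LinearMap.comp_apply, hudef, diffOp_quot_basicSequence_succ hφ j, map_smul, eval_smul,
    eval_smul, smul_eq_mul, smul_eq_mul, hv j, Nat.factorial_succ, Nat.cast_mul, mul_smul_comm]
  have hj1 : ((j + 1 : ℕ) : K) ≠ 0 := Nat.cast_ne_zero.2 (Nat.succ_ne_zero j)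
  rw [mul_div_mul_left _ _ hj1, mul_div_mul_left _ _ hj1, neg_div, neg_smul, sub_eq_add_neg, add_comm]

/-- **Theorem 9, uniqueness of the form**: the coefficients of an operator `Σ_{k≥1} (u_k + x v_k)/(k−1)! Q^k`
annihilating every `s_n` vanish — so two operators of this form with the same eigen-property
`A s_n = n s_n` have the same `u_k`, `v_k` (apply this to their difference).
[cite: RotaKahanerOdlyzko1973, §9 Theorem 9 ("there exists a unique operator of the form"), p. 717] -/
theorem eq_zero_of_sum_smul_pow_apply_eq_zero {δ : K[X] →ₗ[K] K[X]} (hδ : IsDeltaOperator δ)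
    (hs : IsShefferSequence δ s) (u v : ℕ → K)
    (h : ∀ n N : ℕ, n < N →
      ∑ k ∈ range N, (u k • (δ ^ (k + 1)) (s n) + v k • (X * (δ ^ (k + 1)) (s n))) = 0) (k : ℕ) :
    u k = 0 ∧ v k = 0 := by
  induction k using Nat.strong_induction_on with
  | _ k ih =>
    -- test on `s_{k+1}` with `N = k + 1`: only the top term `j = k` survives
    have hk := h (k + 1) (k + 2) (by omega)
    have hvan : ∀ j ∈ range (k + 2), j ≠ k →
        u j • (δ ^ (j + 1)) (s (k + 1)) + v j • (X * (δ ^ (j + 1)) (s (k + 1))) = 0 := by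
      intro j hj hjk
      rcases lt_or_gt_of_ne hjk with hlt | hgt
      · obtain ⟨hu, hv⟩ := ih j hlt
        rw [hu, hv, zero_smul, zero_smul, add_zero]
      · have hdeg : (s (k + 1)).degree < ((j + 1 : ℕ) : WithBot ℕ) := by
          rw [hs.degree_eq]; exact_mod_cast Nat.succ_lt_succ hgt
        have hz : (δ ^ (j + 1)) (s (k + 1)) = 0 := by
          have hmem : j + 1 ∈ range (k + 2 + (j + 1)) := mem_range.2 (by omega)
          obtain ⟨m, rfl⟩ : ∃ m, j = k + 1 + m := ⟨j - (k + 1), by omega⟩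
          rw [show k + 1 + m + 1 = m + 1 + (k + 1) by ring, pow_add, Module.End.mul_apply,
            hs.pow_apply_of_le le_rfl, Nat.sub_self, map_smul, Nat.descFactorial_self]
          have h0 : (δ ^ (m + 1)) (s 0) = 0 := by
            rw [pow_succ, Module.End.mul_apply, hs.apply_zero_eq_C, hδ.map_C, map_zero]
          rw [h0, smul_zero]
        rw [hz, mul_zero, smul_zero, smul_zero, add_zero]
    rw [← sum_erase_add _ _ (mem_range.2 (by omega : k < k + 2)), sum_eq_zero (fun j hj =>
      hvan j (mem_of_mem_erase hj) (ne_of_mem_erase hj)), zero_add,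
      hs.pow_apply_of_le le_rfl, Nat.sub_self, Nat.descFactorial_self, hs.apply_zero_eq_C] at hk
    -- `hk : u k • (k+1)! • C c + v k • (X * ((k+1)! • C c)) = 0` with `c ≠ 0`
    have hc := hs.coeff_zero_apply_zero_ne_zero
    have hf : ((k + 1).factorial : K) ≠ 0 := Nat.cast_ne_zero.2 (Nat.factorial_ne_zero _)
    have h0 := congrArg (coeff · 0) hk
    have h1 := congrArg (coeff · 1) hk
    simp only [coeff_add, coeff_smul, coeff_C_zero, coeff_X_mul_zero, smul_eq_mul, mul_zero, add_zero,
      coeff_zero] at h0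
    simp only [coeff_add, coeff_smul, coeff_C, if_neg one_ne_zero, coeff_X_mul, smul_eq_mul,
      mul_zero, zero_add, coeff_zero] at h1
    exact ⟨by simpa [hf, hc] using h0, by simpa [hf, hc] using h1⟩

end Eigen

/-! ## The Hermite instance: `A = xD − D²` -/

section Hermite

variable (K)

/-- `1 (0) = 1 ≠ 0`: `φ = 1` is invertible, `Q = D · 1(D) = D`. [cite: RotaKahanerOdlyzko1973, §10, p. 726] -/
theorem powerSeries_constantCoeff_one_ne_zero : PowerSeries.constantCoeff (1 : PowerSeries K) ≠ 0 := by
  rw [map_one]; exact one_ne_zero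

/-- The Weierstrass series `σ = e^{t²/2} = (e^{−t²/2})⁻¹` (indicator of `S = W₁`) has `(log S)′ = D`:
`σ′ σ⁻¹ = t`. [cite: RotaKahanerOdlyzko1973, §10 ("`(log S)′ = D`, since `S = W₁`"), p. 726] -/
theorem derivative_expNegHalfSq_inv_mul :
    PowerSeries.derivative K (expNegHalfSq K)⁻¹ * ((expNegHalfSq K)⁻¹)⁻¹ = PowerSeries.X := by
  have hE : PowerSeries.constantCoeff (expNegHalfSq K) ≠ 0 := by
    rw [constantCoeff_expNegHalfSq]; exact one_ne_zero
  have hinv : ((expNegHalfSq K)⁻¹)⁻¹ = expNegHalfSq K := by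
    rw [PowerSeries.inv_eq_iff_mul_eq_one (by rw [PowerSeries.constantCoeff_inv]; exact inv_ne_zero hE),
      PowerSeries.mul_inv_cancel _ hE]
  rw [hinv, PowerSeries.derivative_inv', derivative_expNegHalfSq]
  have h := PowerSeries.inv_mul_cancel (expNegHalfSq K) hE
  linear_combination (PowerSeries.X * ((expNegHalfSq K)⁻¹ * expNegHalfSq K + 1)) * h

/-- The basic set of `Q = D · 1(D) = D` is `xⁿ`. [cite: RotaKahanerOdlyzko1973, §10, p. 726] -/
theorem basicSequence_derivative_comp_diffOp_one (n : ℕ) :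
    (isDeltaOperator_derivative_comp_diffOp (powerSeries_constantCoeff_one_ne_zero K)).basicSequence n = X ^ n := by
  have hb : IsBasicSequence (derivative ∘ₗ diffOp (1 : PowerSeries K) : K[X] →ₗ[K] K[X]) fun n => X ^ n := by
    rw [diffOp_one, LinearMap.comp_id]
    exact isBasicSequence_derivative_X_pow
  rw [← hb.eq_basicSequence]

/-- **`A = xD − D²` for the Hermite polynomials** (`Q = D`, `S = W₁ = e^{D²/2}`: `u₂ = −1`, `v₁ = 1`, all
other coefficients `0`). [cite: RotaKahanerOdlyzko1973, §10, p. 726] -/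
theorem shefferEigenOp_one_weierstrass :
    shefferEigenOp (1 : PowerSeries K) (expNegHalfSq K)⁻¹ =
      LinearMap.mulLeft K (X : K[X]) ∘ₗ derivative - derivative ∘ₗ derivative := by
  have hone : (1 : PowerSeries K)⁻¹ = 1 := by
    rw [PowerSeries.inv_eq_iff_mul_eq_one (powerSeries_constantCoeff_one_ne_zero K), mul_one]
  have h1 : (PowerSeries.derivative K (PowerSeries.X * 1))⁻¹ * (PowerSeries.X * 1) = (PowerSeries.X : PowerSeries K) := by
    rw [mul_one, PowerSeries.derivative_X, hone, one_mul]
  rw [shefferEigenOp, h1, derivative_expNegHalfSq_inv_mul, diffOp_mul, diffOp_X]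

/-- **The Hermite polynomials are eigenfunctions of `xD − D²` with eigenvalues `n`**:
`x He_n′ − He_n″ = n He_n`. [cite: RotaKahanerOdlyzko1973, §10, p. 726] -/
theorem X_mul_derivative_hermite_sub (n : ℕ) :
    X * derivative (Polynomial.map (Int.castRingHom K) (hermite n)) -
        derivative (derivative (Polynomial.map (Int.castRingHom K) (hermite n))) =
      (n : K) • Polynomial.map (Int.castRingHom K) (hermite n) := by
  have hE : PowerSeries.constantCoeff (expNegHalfSq K) ≠ 0 := by
    rw [constantCoeff_expNegHalfSq]; exact one_ne_zero
  have hσ : PowerSeries.constantCoeff (expNegHalfSq K)⁻¹ ≠ 0 := by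
    rw [PowerSeries.constantCoeff_inv]; exact inv_ne_zero hE
  have hs : ∀ m, diffOp (expNegHalfSq K)⁻¹ (Polynomial.map (Int.castRingHom K) (hermite m)) =
      (isDeltaOperator_derivative_comp_diffOp (powerSeries_constantCoeff_one_ne_zero K)).basicSequence m :=
    fun m => by
    rw [basicSequence_derivative_comp_diffOp_one, hermite_eq_diffOp_X_pow, ← LinearMap.comp_apply,
      diffOp_inv_comp_diffOp hE, LinearMap.id_apply]
  have h := shefferEigenOp_apply_sheffer (powerSeries_constantCoeff_one_ne_zero K) hσ hs n
  rwa [shefferEigenOp_one_weierstrass, LinearMap.sub_apply, LinearMap.comp_apply, LinearMap.comp_apply,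
    LinearMap.mulLeft_apply] at h

end Hermite

/-! ## §13: the recurrence for Appell sets -/

section Appell

/-- **"If `p_n (x) = T⁻¹ xⁿ`, then an easy computation gives `p_{n+1} (x) = ((T⁻¹)′ T + x) p_n (x)`"**
(Appell sets; `T⁻¹ = ψ(D)`, `(T⁻¹)′ T = (ψ′/ψ)(D)` by the Pincherle derivative) — "for example, the
recurrence for Hermite polynomials". [cite: RotaKahanerOdlyzko1973, §13 (Appell polynomials), pp. 736–737] -/
theorem appell_succ_eq {ψ : PowerSeries K} (hψ : PowerSeries.constantCoeff ψ ≠ 0) {s : ℕ → K[X]}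
    (hψs : ∀ n, diffOp ψ (X ^ n) = s n) (n : ℕ) :
    s (n + 1) = diffOp (PowerSeries.derivative K ψ * ψ⁻¹) (s n) + X * s n := by
  rw [← hψs, ← hψs, diffOp_mul, LinearMap.comp_apply, ← LinearMap.comp_apply (diffOp ψ⁻¹),
    diffOp_inv_comp_diffOp hψ, LinearMap.id_apply, pow_succ, mul_comm (X ^ n) X, X_mul_diffOp, add_sub_cancel]

/-- The Hermite case `ψ = e^{−t²/2}`, `ψ′/ψ = −t`: `He_{n+1} = x He_n − He_n′` (Mathlib's
`Polynomial.hermite_succ`, recovered). [cite: RotaKahanerOdlyzko1973, §13, p. 737] -/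
theorem hermite_map_succ (n : ℕ) :
    Polynomial.map (Int.castRingHom K) (hermite (n + 1)) =
      X * Polynomial.map (Int.castRingHom K) (hermite n) - derivative (Polynomial.map (Int.castRingHom K) (hermite n)) := by
  have hE : PowerSeries.constantCoeff (expNegHalfSq K) ≠ 0 := by
    rw [constantCoeff_expNegHalfSq]; exact one_ne_zero
  have hq : PowerSeries.derivative K (expNegHalfSq K) * (expNegHalfSq K)⁻¹ = -PowerSeries.X := by
    rw [derivative_expNegHalfSq]
    have h := PowerSeries.mul_inv_cancel (expNegHalfSq K) hE
    linear_combination (-PowerSeries.X) * h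
  have h := appell_succ_eq hE (fun m => (hermite_eq_diffOp_X_pow K m).symm) n
  rw [hq, diffOp_neg, LinearMap.neg_apply, diffOp_X] at h
  rw [h]
  ring

end Appell

end Literature.Algebra.Polynomial
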